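import Summits.Langlands.Langlands.Theses.NonParallelVoid
import Literature.NumberTheory.Automorphic.Qian2022PotentialAutomorphy
import Literature.NumberTheory.GaloisRepresentations.FramedRepTwist
import Literature.NumberTheory.GaloisRepresentations.InducedGaloisRep
import Literature.NumberTheory.GaloisRepresentations.PstCrystallineExtensionData
import HarnessLib

/-!
# Route `NonParallelVoid`, crux `TwistedInductionParallel` (stmt-Langlands-17000): vocabulary of the
# line `symmetrise-pd-split`, and its glue stub `stub_nonParallelPairOfNotParallel`

Route-posited objects (D-0016 `<Route>Defs`-type file) shared by the four registered stubs of the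
checked skeleton `Cruxes/TwistedInductionParallel/Lines/symmetrise_pd_split.lean` (skeleton sha
`26383c4f…`, registered 2026-08-17 by `ledger skeleton check`, lead prover-line-stmt-Langlands-17000-0)
and by the crux file that composes them.  NOTHING IS ASSERTED by the definitions: every
`def … : Prop` below is a *statement* consumed only as (part of) the type of a stub theorem or of the
crux.  Declared in the skeleton's namespace
`Summit.Langlands.Langlands.Cruxes.TwistedInductionParallel.SymmetrisePdSplit`, so that a landed stub
`theorem stub_<name> : <registered signature>` reads byte-identically to its registration.

Objects (all but the last four are VERBATIM sub-formulas of the route decl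
`Summit.Langlands.Langlands.Theses.NonParallelVoid.TwistedInductionParallel`; the composition in the
skeleton is `intro`/`exact` on them):
* `HasTwoWeights F p ρ` — de Rham at every `v ∣ p` (pinned Fontaine datum) with two distinct
  `τ`-labelled Hodge–Tate weights `{a, b}`, `a < b`, at every label;
* `GoodRegime F p ρ` — `11 ≤ p`, `p` split in `F`, `ρ` crystalline at every `v ∣ p`,
  `ρ̄|Γ_(F(ζ_p))` absolutely irreducible;
* `SameParity F p ρ` — any two labelled gaps have even sum;
* `Parallel F p ρ` — the crux's conclusion: one gap `g` for all labels;
* `NonParallelPair F p ρ` — two labels whose gaps differ (the regularity input of the lever);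
* `PDAbove F p ρ` — potential diagonalisability of `ρ|Γ_{F_v}` at every `v ∣ p` relative to every
  compatible crystalline extension datum (`PstCrystallineExtensionData`) of the pinned datum;
* `IsAlgebraicAbove p E χ` — a continuous `p`-adic character of `Γ_E` is crystalline above `p` with
  one labelled weight at every label (the `p`-adic avatar of an algebraic Hecke character
  unramified above `p`);
* `SymmetrisingTwistDatum F p ρ` — WAYPOINT 1 (output of `stub_symmetrisingTwist`): a totally real
  `K`, a CM quadratic extension `E/K` with `F ⊆ E`, `χ : Γ_E → ℚ̄_pˣ` algebraic-crystalline above `p`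
  and `θ : Γ_K → ℚ̄_pˣ` with `det(ρ|_E ⊗ χ) = θ|_E`, `θ` totally odd, `Ind_E^K(ρ|_E ⊗ χ)|K(ζ_p)`
  residually absolutely irreducible;
* `AutomorphicTwistOverCM F p ρ` — WAYPOINT 2 (output of `stub_potentialAutomorphyOfTwist`): a CM
  `E' ⊇ F`, `χ'` algebraic-crystalline above `p` and `ι` with `ρ|_{E'} ⊗ χ'` automorphic in the
  sense of Qian 2023 Def. 1.3 (`Qian2022.IsAutomorphic`).

Proved here (so that this vocabulary lands through a registered stub, `--supports`): the line's glue
stub `stub_nonParallelPairOfNotParallel` (registered signature, verbatim) — from `¬ Parallel` and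
`HasTwoWeights` to a `NonParallelPair`, pure logic on the weight data.

Not here (deliberately): the four open stub statements and the composition (they stay in the crux
workfile until proved; each lands in its own `Theorems/NonParallelVoidTwistedInductionParallel<Stub>.lean`).

References: BarnetlambEtAl2014 (Thm. C, §1.4, §2.1), ArthurClozelAMS120 (Ch. 3 Thm. 4.2, Lemma 6.3),
HarrisLanTaylorThorneRMS2016 (Thm. A), Qian2022 (Def. 1.3), Clozel1990 (Lemme 4.9).
-/

noncomputable section

open scoped NumberField
open NumberField IsDedekindDomain Field Filter
open Literature.NumberTheory.GaloisRepresentations Literature.NumberTheory.PAdicHodge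
open Literature.NumberTheory.Automorphic

-- `Summit.Langlands.Langlands.…` repeats a namespace component by design (D-0017 nested layout).
set_option linter.dupNamespace false

namespace Summit.Langlands.Langlands.Cruxes.TwistedInductionParallel.SymmetrisePdSplit

/-! ## 0. The hypothesis packages of the crux (verbatim sub-formulas of the route decl) -/

section Packages

/-- The crux's `p`-adic Hodge hypothesis: `ρ` is de Rham at every `v ∣ p` (pinned Fontaine datum)
with two distinct `τ`-labelled Hodge–Tate weights `{a, b}`, `a < b`, at every label. Verbatim
sub-formula of `TwistedInductionParallel`. [folklore] -/
def HasTwoWeights (F : Type) [Field F] [NumberField F] (p : ℕ) [Fact p.Prime]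
    (ρ : FramedGaloisRep F (PadicAlgCl p) 2) : Prop :=
  ∀ (v : IsDedekindDomain.HeightOneSpectrum (NumberField.RingOfIntegers F))
    (hv : ((p : ℕ) : NumberField.RingOfIntegers F) ∈ v.asIdeal),
    (Literature.NumberTheory.PAdicHodge.fontainePstAdicCompletion v p hv).IsDeRhamFramed (ρ.toLocal v) ∧
    (letI := (Literature.NumberTheory.PAdicHodge.fontainePstAdicCompletion v p hv).algebra
     ∀ τ : v.adicCompletion F →ₐ[ℚ_[p]] PadicAlgCl p, ∃ a b : ℤ, a < b ∧
      ρ.labelledHodgeTateWeightsAt v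
        (Literature.NumberTheory.PAdicHodge.fontainePstAdicCompletion v p hv).algebra
        (Literature.NumberTheory.PAdicHodge.fontainePstAdicCompletion v p hv).𝔅 τ.toRingHom = {a, b})

/-- The crux's "good regime": `p ≥ 11`, `p` split in `F` (two distinct places above `p`), `ρ`
crystalline at every `v ∣ p`, `ρ̄|Γ_(F(ζ_p))` absolutely irreducible. Verbatim sub-formula of
`TwistedInductionParallel`. [folklore] -/
def GoodRegime (F : Type) [Field F] [NumberField F] (p : ℕ) [Fact p.Prime]
    (ρ : FramedGaloisRep F (PadicAlgCl p) 2) : Prop :=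
  11 ≤ p ∧
  (∃ v w : IsDedekindDomain.HeightOneSpectrum (NumberField.RingOfIntegers F), v ≠ w ∧
    ((p : ℕ) : NumberField.RingOfIntegers F) ∈ v.asIdeal ∧
    ((p : ℕ) : NumberField.RingOfIntegers F) ∈ w.asIdeal) ∧
  (∀ (v : IsDedekindDomain.HeightOneSpectrum (NumberField.RingOfIntegers F))
    (hv : ((p : ℕ) : NumberField.RingOfIntegers F) ∈ v.asIdeal),
    (Literature.NumberTheory.PAdicHodge.fontainePstAdicCompletion v p hv).IsCrystallineFramed
      (ρ.toLocal v)) ∧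
  Literature.NumberTheory.GaloisRepresentations.FramedGaloisRep.IsResiduallyAbsIrreducible
    (ρ.restrictField (CyclotomicField p F))

/-- The crux's parity hypothesis: any two labelled gaps have an even sum (equivalently, an even
difference). Verbatim sub-formula of `TwistedInductionParallel`. [folklore] -/
def SameParity (F : Type) [Field F] [NumberField F] (p : ℕ) [Fact p.Prime]
    (ρ : FramedGaloisRep F (PadicAlgCl p) 2) : Prop :=
  ∀ (v : IsDedekindDomain.HeightOneSpectrum (NumberField.RingOfIntegers F))
    (hv : ((p : ℕ) : NumberField.RingOfIntegers F) ∈ v.asIdeal)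
    (w : IsDedekindDomain.HeightOneSpectrum (NumberField.RingOfIntegers F))
    (hw : ((p : ℕ) : NumberField.RingOfIntegers F) ∈ w.asIdeal),
    letI := (Literature.NumberTheory.PAdicHodge.fontainePstAdicCompletion v p hv).algebra
    letI := (Literature.NumberTheory.PAdicHodge.fontainePstAdicCompletion w p hw).algebra
    ∀ (τ : v.adicCompletion F →ₐ[ℚ_[p]] PadicAlgCl p) (σ : w.adicCompletion F →ₐ[ℚ_[p]] PadicAlgCl p)
      (a b a' b' : ℤ),
      ρ.labelledHodgeTateWeightsAt v
          (Literature.NumberTheory.PAdicHodge.fontainePstAdicCompletion v p hv).algebra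
          (Literature.NumberTheory.PAdicHodge.fontainePstAdicCompletion v p hv).𝔅 τ.toRingHom = {a, b} →
        a < b →
      ρ.labelledHodgeTateWeightsAt w
          (Literature.NumberTheory.PAdicHodge.fontainePstAdicCompletion w p hw).algebra
          (Literature.NumberTheory.PAdicHodge.fontainePstAdicCompletion w p hw).𝔅 σ.toRingHom = {a', b'} →
        a' < b' → Even (b - a + (b' - a'))

/-- The crux's conclusion: one gap `g` for all labels. Verbatim sub-formula of
`TwistedInductionParallel`. [folklore] -/
def Parallel (F : Type) [Field F] [NumberField F] (p : ℕ) [Fact p.Prime]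
    (ρ : FramedGaloisRep F (PadicAlgCl p) 2) : Prop :=
  ∃ g : ℤ, ∀ (v : IsDedekindDomain.HeightOneSpectrum (NumberField.RingOfIntegers F))
    (hv : ((p : ℕ) : NumberField.RingOfIntegers F) ∈ v.asIdeal),
    letI := (Literature.NumberTheory.PAdicHodge.fontainePstAdicCompletion v p hv).algebra
    ∀ τ : v.adicCompletion F →ₐ[ℚ_[p]] PadicAlgCl p, ∃ a : ℤ,
      ρ.labelledHodgeTateWeightsAt v
        (Literature.NumberTheory.PAdicHodge.fontainePstAdicCompletion v p hv).algebra
        (Literature.NumberTheory.PAdicHodge.fontainePstAdicCompletion v p hv).𝔅 τ.toRingHom = {a, a + g}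

/-- **A non-parallel pair of labels**: two labels `(v, τ)`, `(w, σ)` above `p` whose gaps differ.
This is the REGULARITY input of the lever: after the symmetrising twist the two weight pairs of
`ρ ⊗ χ` above a place of `K` are concentric, so the induced representation is Hodge–Tate regular
exactly when the radii (= half the gaps) differ. [folklore] -/
def NonParallelPair (F : Type) [Field F] [NumberField F] (p : ℕ) [Fact p.Prime]
    (ρ : FramedGaloisRep F (PadicAlgCl p) 2) : Prop :=
  ∃ (v : IsDedekindDomain.HeightOneSpectrum (NumberField.RingOfIntegers F))
    (hv : ((p : ℕ) : NumberField.RingOfIntegers F) ∈ v.asIdeal)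
    (w : IsDedekindDomain.HeightOneSpectrum (NumberField.RingOfIntegers F))
    (hw : ((p : ℕ) : NumberField.RingOfIntegers F) ∈ w.asIdeal),
    letI := (Literature.NumberTheory.PAdicHodge.fontainePstAdicCompletion v p hv).algebra
    letI := (Literature.NumberTheory.PAdicHodge.fontainePstAdicCompletion w p hw).algebra
    ∃ (τ : v.adicCompletion F →ₐ[ℚ_[p]] PadicAlgCl p) (σ : w.adicCompletion F →ₐ[ℚ_[p]] PadicAlgCl p)
      (a b a' b' : ℤ),
      ρ.labelledHodgeTateWeightsAt v
          (Literature.NumberTheory.PAdicHodge.fontainePstAdicCompletion v p hv).algebra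
          (Literature.NumberTheory.PAdicHodge.fontainePstAdicCompletion v p hv).𝔅 τ.toRingHom = {a, b} ∧
        a < b ∧
      ρ.labelledHodgeTateWeightsAt w
          (Literature.NumberTheory.PAdicHodge.fontainePstAdicCompletion w p hw).algebra
          (Literature.NumberTheory.PAdicHodge.fontainePstAdicCompletion w p hw).𝔅 σ.toRingHom = {a', b'} ∧
        a' < b' ∧ b - a ≠ b' - a'

/-- **Potential diagonalisability of `ρ` at every place above `p`**, relative to the pinned Fontaine
datum and EVERY compatible crystalline extension datum (`PstCrystallineExtensionData`, intended
`K' ↦ B_cris(K')`): the `ℓ = p` hypothesis of BLGGT Thm. C for the two crystalline pieces of the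
induced representation. [cite: BarnetlambEtAl2014, §1.4] -/
def PDAbove (F : Type) [Field F] [NumberField F] (p : ℕ) [Fact p.Prime]
    (ρ : FramedGaloisRep F (PadicAlgCl p) 2) : Prop :=
  ∀ (v : IsDedekindDomain.HeightOneSpectrum (NumberField.RingOfIntegers F))
    (hv : ((p : ℕ) : NumberField.RingOfIntegers F) ∈ v.asIdeal)
    (𝔈 : PstCrystallineExtensionData (Literature.NumberTheory.PAdicHodge.fontainePstAdicCompletion v p hv)),
    letI := (Literature.NumberTheory.PAdicHodge.fontainePstAdicCompletion v p hv).algebra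
    IsPotentiallyDiagonalizable 𝔈.𝔅 (ρ.toLocal v)

/-- A continuous `p`-adic character `χ` of `Γ_E` (`E` a number field) is **Hodge–Tate-algebraic and
crystalline above `p`**: at every place `u ∣ p` of `E` the rank-one representation `χ · 1` is
crystalline (pinned datum) and has ONE labelled Hodge–Tate weight `{k}` at every label (intended: the
`p`-adic avatar of an algebraic Hecke character of `E` unramified above `p`). [folklore] -/
def IsAlgebraicAbove (p : ℕ) [Fact p.Prime] (E : Type) [Field E] [NumberField E]
    (χ : absoluteGaloisGroup E →ₜ* (PadicAlgCl p)ˣ) : Prop :=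
  ∀ (u : IsDedekindDomain.HeightOneSpectrum (NumberField.RingOfIntegers E))
    (hu : ((p : ℕ) : NumberField.RingOfIntegers E) ∈ u.asIdeal),
    (Literature.NumberTheory.PAdicHodge.fontainePstAdicCompletion u p hu).IsCrystallineFramed
      (FramedGaloisRep.toLocal u
        ((FramedRep.scalar (PadicAlgCl p) 1).comp χ : FramedGaloisRep E (PadicAlgCl p) 1)) ∧
    (letI := (Literature.NumberTheory.PAdicHodge.fontainePstAdicCompletion u p hu).algebra
     ∀ τ : u.adicCompletion E →ₐ[ℚ_[p]] PadicAlgCl p, ∃ k : ℤ,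
      FramedGaloisRep.labelledHodgeTateWeightsAt
        ((FramedRep.scalar (PadicAlgCl p) 1).comp χ : FramedGaloisRep E (PadicAlgCl p) 1) u
        (Literature.NumberTheory.PAdicHodge.fontainePstAdicCompletion u p hu).algebra
        (Literature.NumberTheory.PAdicHodge.fontainePstAdicCompletion u p hu).𝔅 τ.toRingHom = {k})

/-- **WAYPOINT 1 — the symmetrising twist datum** (output of `stub_symmetrisingTwist`, input of
`stub_potentialAutomorphyOfTwist`).  A totally real number field `K`, a CM number field `E` which is
a quadratic extension of `K` and an extension of `F` (intended: `K` real quadratic, `E = F·K`), a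
continuous character `χ : Γ_E → ℚ̄_pˣ` algebraic and crystalline above `p`, and a continuous
character `θ : Γ_K → ℚ̄_pˣ` such that
(b) `det(ρ|_E ⊗ χ) = θ|_E` — the determinant of the twist DESCENDS to the totally real field, which is
exactly what makes `Ind_E^K(ρ|_E ⊗ χ)` essentially self-dual (symplectic, multiplier `θ`);
(c) `θ` is totally odd (`θ(c_v) = −1` at every real place: uniform sign, as BLGGT's polarised
representations over totally real fields require);
(d) the residual representation of `Ind_E^K(ρ|_E ⊗ χ)` restricted to `K(ζ_p)` is absolutely
irreducible (generic finite part of `χ`). [cite: BarnetlambEtAl2014, §2.1 and Thm. C] -/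
def SymmetrisingTwistDatum (F : Type) [Field F] [NumberField F] (p : ℕ) [Fact p.Prime]
    (ρ : FramedGaloisRep F (PadicAlgCl p) 2) : Prop :=
  ∃ (K E : Type) (_ : Field K) (_ : NumberField K) (_ : Field E) (_ : NumberField E)
    (_ : Algebra F E) (_ : Algebra K E) (hd : Module.finrank K E = 2),
    NumberField.IsTotallyReal K ∧ NumberField.IsCMField E ∧
    ∃ (χ : absoluteGaloisGroup E →ₜ* (PadicAlgCl p)ˣ) (θ : absoluteGaloisGroup K →ₜ* (PadicAlgCl p)ˣ),
      IsAlgebraicAbove p E χ ∧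
      FramedRep.det (FramedRep.twist (ρ.restrictField E) χ) = θ.comp (absGaloisRestrict K E) ∧
      FramedGaloisRep.IsOdd ((FramedRep.scalar (PadicAlgCl p) 1).comp θ : FramedGaloisRep K (PadicAlgCl p) 1) ∧
      FramedGaloisRep.IsResiduallyAbsIrreducible
        ((FramedGaloisRep.induce K hd (FramedRep.twist (ρ.restrictField E) χ)).restrictField
          (CyclotomicField p K))

/-- **WAYPOINT 2 — an automorphic algebraic twist over a CM field** (output of
`stub_potentialAutomorphyOfTwist`, input of `stub_parallelOfAutomorphicTwist`): a CM number field
`E' ⊇ F` (intended `E' = E·K'`, `K'/K` totally real Galois from BLGGT Thm. C), a character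
`χ' : Γ_{E'} → ℚ̄_pˣ` algebraic and crystalline above `p` (intended `χ|Γ_{E'}`), and `ι : ℚ̄_p ≃ ℂ`
such that `ρ|_{E'} ⊗ χ'` is automorphic in the sense of Qian 2023 Def. 1.3 (`≅ r_ι(π₂)` for a
regular algebraic cuspidal `π₂` on `GL₂(𝔸_{E'})`, via HLTT's characterising property).  No
automorphic representation is constructible in the tree, so the waypoint is not cheaply inhabited.
[cite: Qian2022, Def. 1.3] [cite: HarrisLanTaylorThorneRMS2016, Thm. A] -/
def AutomorphicTwistOverCM (F : Type) [Field F] [NumberField F] (p : ℕ) [Fact p.Prime]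
    (ρ : FramedGaloisRep F (PadicAlgCl p) 2) : Prop :=
  ∃ (E' : Type) (_ : Field E') (_ : NumberField E') (_ : Algebra F E'),
    NumberField.IsCMField E' ∧
    ∃ (χ' : absoluteGaloisGroup E' →ₜ* (PadicAlgCl p)ˣ) (ι : PadicAlgCl p ≃+* ℂ),
      IsAlgebraicAbove p E' χ' ∧
      Qian2022.IsAutomorphic ι (FramedRep.twist (ρ.restrictField E') χ')

end Packages

/-! ## 1. The glue stub (registered; proved) -/

/-- **STUB 0 (glue, PROVED) — from `¬ Parallel` to a non-parallel pair of labels** (pure logic on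
the weight data): `g := 0` in `¬ Parallel` yields some label `(v₁, τ₁)`; its gap `g₁` (from
`HasTwoWeights`) fed back into `¬ Parallel` yields a label `(v₂, τ₂)` with weights `{a₂, b₂}` which
is not of the form `{a, a + g₁}`, hence `b₂ − a₂ ≠ g₁`.  Registered so that the vocabulary file
`Theorems/NonParallelVoidTwistedInductionParallelSymmetriseDefs.lean` lands through a stub
(`--supports`); closed signature. [folklore] -/
theorem stub_nonParallelPairOfNotParallel :
    ∀ (F : Type) [Field F] [NumberField F] (p : ℕ) [Fact p.Prime]
    (ρ : FramedGaloisRep F (PadicAlgCl p) 2),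
    HasTwoWeights F p ρ → ¬ Parallel F p ρ → NonParallelPair F p ρ := by
  intro F _ _ p _ ρ hHT hC
  classical
  simp only [Parallel, not_exists, not_forall] at hC
  -- a first label, from `g := 0`
  obtain ⟨v₁, hv₁, τ₁, _⟩ := hC 0
  obtain ⟨a₁, b₁, hab₁, h₁⟩ := (hHT v₁ hv₁).2 τ₁
  -- a label whose weights are not `{a, a + (b₁ - a₁)}`
  obtain ⟨v₂, hv₂, τ₂, h₂⟩ := hC (b₁ - a₁)
  obtain ⟨a₂, b₂, hab₂, h₂'⟩ := (hHT v₂ hv₂).2 τ₂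
  refine ⟨v₁, hv₁, v₂, hv₂, τ₁, τ₂, a₁, b₁, a₂, b₂, h₁, hab₁, h₂', hab₂, ?_⟩
  intro hgap
  refine h₂ a₂ ?_
  rw [h₂', show a₂ + (b₁ - a₁) = b₂ by omega]


/-! ## 2. Skeleton v4 vocabulary (lead 0, cycle 1; appended — the declarations above are byte-identical)

Wave-1 verdicts (2026-08-17): stub 1 `stub-misstated` (the crystalline conjunct of `IsAlgebraicAbove` is
underivable for the ε-pinned datum ⇒ syntactic `IsLocallyAlgebraicAbove`; datum re-typed
`SymmetrisingTwistDatumLA` with the shape `θ = θ₀ · ε_K^t`), stub 4 `stub-misstated` and then PROVED with its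
four in-print inputs as leading hypotheses (consuming only the de Rham / one-weight clauses of the twisting
character ⇒ waypoint 2 re-typed `AutomorphicTwistOverCMHT` over `IsHodgeTateAlgebraicAbove`), and the new
waypoint 2' `InducedTwistAutomorphic` = the literal conclusion of the landed named fact
`BLGGT2014_thmC_potentialAutomorphy` for the induced twist (between stub 3 and the new descent stub 3').
Registered skeleton: `Cruxes/TwistedInductionParallel/Lines/symmetrise_pd_split.lean` (v4, 7 stubs).  As
above, NOTHING IS ASSERTED: every `def … : Prop` is a statement consumed as (part of) the type of a stub. -/

section VocabularyV4

/-- **`χ` is locally algebraic above `p`, SYNTACTICALLY** (wave-1 stub-1 verdict: the crystalline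
conjunct of `IsAlgebraicAbove` is underivable for the ε-pinned datum; this replaces it): at every place
`u ∣ p` of `E` there is `k : ℤ` with `χ = ε_{E_u}^k` on the inertia group of `E_u` (so `χ|Γ_{E_u}` is an
unramified twist of a power of the cyclotomic character — the `p`-adic avatar of an algebraic Hecke
character, read on inertia).  De Rham-ness and the single labelled weight `{k}` FOLLOW unconditionally
(`LocallyCyclotomicCharacterDeRham`, p167630). [folklore] -/
def IsLocallyAlgebraicAbove (p : ℕ) [Fact p.Prime] (E : Type) [Field E] [NumberField E]
    (χ : absoluteGaloisGroup E →ₜ* (PadicAlgCl p)ˣ) : Prop :=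
  ∀ (u : IsDedekindDomain.HeightOneSpectrum (NumberField.RingOfIntegers E))
    (_ : ((p : ℕ) : NumberField.RingOfIntegers E) ∈ u.asIdeal),
    ∃ k : ℤ, ∀ σ : absoluteGaloisGroup (u.adicCompletion E), σ ∈ absInertia (u.adicCompletion E) →
      ((χ (absGaloisRestrict E (u.adicCompletion E) σ) : (PadicAlgCl p)ˣ) : PadicAlgCl p) =
        (algebraMap ℚ_[p] (PadicAlgCl p)
          ((GaloisRep.cyclotomicCharacter (u.adicCompletion E) p σ : ℤ_[p]ˣ) : ℤ_[p])) ^ k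

/-- **WAYPOINT 1, re-typed (v4): `SymmetrisingTwistDatumLA`.**  The registered `SymmetrisingTwistDatum`
with `IsAlgebraicAbove p E χ` replaced by the syntactic `IsLocallyAlgebraicAbove p E χ`, and with the extra
(construction-free) conjunct that the descended determinant has the shape `θ = θ₀ · ε_K^t` with `θ₀` of
finite image and `t : ℤ` (the parallel weight of `θ`).  Clauses (b) determinant descent, (c) total
oddness, (d) residual absolute irreducibility of `Ind_E^K(ρ|_E ⊗ χ)|K(ζ_p)` are VERBATIM those of the
registered datum.  (Wave-1 stub-1 worker's `SymmetrisingTwistDatumLA`, checked rc 0.)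
[cite: BarnetlambEtAl2014, §2.1 and Thm. C] -/
def SymmetrisingTwistDatumLA (F : Type) [Field F] [NumberField F] (p : ℕ) [Fact p.Prime]
    (ρ : FramedGaloisRep F (PadicAlgCl p) 2) : Prop :=
  ∃ (K E : Type) (_ : Field K) (_ : NumberField K) (_ : Field E) (_ : NumberField E)
    (_ : Algebra F E) (_ : Algebra K E) (hd : Module.finrank K E = 2),
    NumberField.IsTotallyReal K ∧ NumberField.IsCMField E ∧
    ∃ (χ : absoluteGaloisGroup E →ₜ* (PadicAlgCl p)ˣ) (θ : absoluteGaloisGroup K →ₜ* (PadicAlgCl p)ˣ),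
      IsLocallyAlgebraicAbove p E χ ∧
      (∃ (t : ℤ) (θ₀ : absoluteGaloisGroup K →ₜ* (PadicAlgCl p)ˣ), (Set.range θ₀).Finite ∧
        ∀ σ : absoluteGaloisGroup K, ((θ σ : (PadicAlgCl p)ˣ) : PadicAlgCl p) =
          (θ₀ σ : PadicAlgCl p) *
            (algebraMap ℚ_[p] (PadicAlgCl p)
              ((GaloisRep.cyclotomicCharacter K p σ : ℤ_[p]ˣ) : ℤ_[p])) ^ t) ∧
      FramedRep.det (FramedRep.twist (ρ.restrictField E) χ) = θ.comp (absGaloisRestrict K E) ∧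
      FramedGaloisRep.IsOdd ((FramedRep.scalar (PadicAlgCl p) 1).comp θ : FramedGaloisRep K (PadicAlgCl p) 1) ∧
      FramedGaloisRep.IsResiduallyAbsIrreducible
        ((FramedGaloisRep.induce K hd (FramedRep.twist (ρ.restrictField E) χ)).restrictField
          (CyclotomicField p K))

/-- **`χ` is Hodge–Tate-algebraic above `p`**: the registered `IsAlgebraicAbove` WITHOUT its crystalline
conjunct — at every `u ∣ p` the rank-one framed `χ · 1` is de Rham for THE pinned datum and has one
labelled Hodge–Tate weight `{k}` at every `ℚ_p`-label (exactly what stub 4 consumes; implied by the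
syntactic `IsLocallyAlgebraicAbove`, unconditionally — wave-1 stub-1 worker's
`isHodgeTateAlgebraicAbove_of_isLocallyAlgebraicAbove`, via `LocallyCyclotomicCharacterDeRham` p167630).
[folklore] -/
def IsHodgeTateAlgebraicAbove (p : ℕ) [Fact p.Prime] (E : Type) [Field E] [NumberField E]
    (χ : absoluteGaloisGroup E →ₜ* (PadicAlgCl p)ˣ) : Prop :=
  ∀ (u : IsDedekindDomain.HeightOneSpectrum (NumberField.RingOfIntegers E))
    (hu : ((p : ℕ) : NumberField.RingOfIntegers E) ∈ u.asIdeal),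
    (Literature.NumberTheory.PAdicHodge.fontainePstAdicCompletion u p hu).IsDeRhamFramed
      (FramedGaloisRep.toLocal u
        ((FramedRep.scalar (PadicAlgCl p) 1).comp χ : FramedGaloisRep E (PadicAlgCl p) 1)) ∧
    (letI := (Literature.NumberTheory.PAdicHodge.fontainePstAdicCompletion u p hu).algebra
     ∀ τ : u.adicCompletion E →ₐ[ℚ_[p]] PadicAlgCl p, ∃ k : ℤ,
      FramedGaloisRep.labelledHodgeTateWeightsAt
        ((FramedRep.scalar (PadicAlgCl p) 1).comp χ : FramedGaloisRep E (PadicAlgCl p) 1) u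
        (Literature.NumberTheory.PAdicHodge.fontainePstAdicCompletion u p hu).algebra
        (Literature.NumberTheory.PAdicHodge.fontainePstAdicCompletion u p hu).𝔅 τ.toRingHom = {k})

/-- The registered `IsAlgebraicAbove` implies the Hodge–Tate version (crystalline ⇒ de Rham).
[folklore] -/
theorem isHodgeTateAlgebraicAbove_of_isAlgebraicAbove {p : ℕ} [Fact p.Prime] {E : Type} [Field E]
    [NumberField E] {χ : absoluteGaloisGroup E →ₜ* (PadicAlgCl p)ˣ} (h : IsAlgebraicAbove p E χ) :
    IsHodgeTateAlgebraicAbove p E χ :=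
  fun u hu => ⟨(h u hu).1.isDeRhamFramed, (h u hu).2⟩

/-- **WAYPOINT 2, re-typed (v4): `AutomorphicTwistOverCMHT`** — the registered `AutomorphicTwistOverCM`
with `IsAlgebraicAbove p E' χ'` replaced by `IsHodgeTateAlgebraicAbove p E' χ'` (stub 4 consumes only the
de Rham / one-weight clauses: wave-1 stub-4 proof, `hcr.isDeRhamFramed` and `hk`): a CM number field
`E' ⊇ F`, `χ' : Γ_{E'} → ℚ̄_pˣ` Hodge–Tate-algebraic above `p`, and `ι : ℚ̄_p ≃ ℂ` with `ρ|_{E'} ⊗ χ'`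
automorphic in the sense of Qian 2023 Def. 1.3. [cite: Qian2022, Def. 1.3] [cite: HarrisLanTaylorThorneRMS2016, Thm. A] -/
def AutomorphicTwistOverCMHT (F : Type) [Field F] [NumberField F] (p : ℕ) [Fact p.Prime]
    (ρ : FramedGaloisRep F (PadicAlgCl p) 2) : Prop :=
  ∃ (E' : Type) (_ : Field E') (_ : NumberField E') (_ : Algebra F E'),
    NumberField.IsCMField E' ∧
    ∃ (χ' : absoluteGaloisGroup E' →ₜ* (PadicAlgCl p)ˣ) (ι : PadicAlgCl p ≃+* ℂ),
      IsHodgeTateAlgebraicAbove p E' χ' ∧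
      Qian2022.IsAutomorphic ι (FramedRep.twist (ρ.restrictField E') χ')

/-- **WAYPOINT 2' — the induced twist is automorphic over a totally real extension** (conclusion of
BLGGT Thm. C for `I = Ind_E^K(ρ|_E ⊗ χ)`, VERBATIM its shape, together with the fields of the
symmetrising datum that the descent consumes): a totally real `K`, a CM quadratic `E/K` with `F ⊆ E`,
`χ` locally algebraic above `p` (syntactic), `θ = θ₀ · ε_K^t` with `det(ρ|_E ⊗ χ) = θ|_E`, the residual absolute
irreducibility of `I|K(ζ_p)`, and a finite Galois totally real `K'/K` with `ι : ℚ̄_p ≃ ℂ` such that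
`I|Γ_{K'}` is semisimple and HLTT-compatible with a regular algebraic cuspidal `Π` of `GL₄(𝔸_{K'})`.
[cite: BarnetlambEtAl2014, Theorem C (= Cor. 4.5.2)] -/
def InducedTwistAutomorphic (F : Type) [Field F] [NumberField F] (p : ℕ) [Fact p.Prime]
    (ρ : FramedGaloisRep F (PadicAlgCl p) 2) : Prop :=
  ∃ (K E : Type) (_ : Field K) (_ : NumberField K) (_ : Field E) (_ : NumberField E)
    (_ : Algebra F E) (_ : Algebra K E) (hd : Module.finrank K E = 2),
    NumberField.IsTotallyReal K ∧ NumberField.IsCMField E ∧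
    ∃ (χ : absoluteGaloisGroup E →ₜ* (PadicAlgCl p)ˣ) (θ : absoluteGaloisGroup K →ₜ* (PadicAlgCl p)ˣ),
      IsLocallyAlgebraicAbove p E χ ∧
      (∃ (t : ℤ) (θ₀ : absoluteGaloisGroup K →ₜ* (PadicAlgCl p)ˣ), (Set.range θ₀).Finite ∧
        ∀ σ : absoluteGaloisGroup K, ((θ σ : (PadicAlgCl p)ˣ) : PadicAlgCl p) =
          (θ₀ σ : PadicAlgCl p) *
            (algebraMap ℚ_[p] (PadicAlgCl p)
              ((GaloisRep.cyclotomicCharacter K p σ : ℤ_[p]ˣ) : ℤ_[p])) ^ t) ∧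
      FramedRep.det (FramedRep.twist (ρ.restrictField E) χ) = θ.comp (absGaloisRestrict K E) ∧
      FramedGaloisRep.IsResiduallyAbsIrreducible
        ((FramedGaloisRep.induce K hd (FramedRep.twist (ρ.restrictField E) χ)).restrictField
          (CyclotomicField p K)) ∧
      ∃ (K' : Type) (_ : Field K') (_ : NumberField K') (_ : Algebra K K'),
        IsGalois K K' ∧ NumberField.IsTotallyReal K' ∧
        ∃ ι : PadicAlgCl p ≃+* ℂ,
          (((FramedGaloisRep.induce K hd (FramedRep.twist (ρ.restrictField E) χ)).restrictField K')
              ).toGaloisRep.IsSemisimple ∧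
          ∃ (hcpt : isCompact_glFiniteIntegralLevel (2 * 2) K')
            (π₄ : CuspidalAutomorphicRepData (2 * 2) K' hcpt),
            π₄.1.IsRegularAlgebraic ∧
            HarrisLanTaylorThorne2016.IsCompatible π₄.1 ι
              ((FramedGaloisRep.induce K hd (FramedRep.twist (ρ.restrictField E) χ)).restrictField K')

end VocabularyV4

end Summit.Langlands.Langlands.Cruxes.TwistedInductionParallel.SymmetrisePdSplit
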